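import Summits.RiemannHypothesis.RiemannHypothesis.Theorems.WeilTwoPrimeDeflC83XBase
import Literature.NumberTheory.LFunctions.WeilBlockRowsPZ
import HarnessLib

/-!
# Deflated two-prime certificate C83X: the factored even inverse agrees with `D`, rows 4–7

`WeilCert.checkDnRow` (even block) for certificate C83X, by `decide +kernel`. Pure proof file.
-/

set_option linter.dupNamespace false

noncomputable section

namespace Summit.RiemannHypothesis.RiemannHypothesis.Theorems.EvenWinsBeyondArch

open Literature.NumberTheory.LFunctions

set_option maxHeartbeats 0 in
/-- Row 4 of `DnE/LsE` is row 4 of the even `D` (certificate C83X). [folklore] -/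
theorem checkDnRow0_4_weilCertDeflC83X : weilCertDeflC83XBase.checkDnRow weilCertDeflC83XDnE weilCertDeflC83XLsE 0 4 = true := by
  decide +kernel

set_option maxHeartbeats 0 in
/-- Row 5 of `DnE/LsE` is row 5 of the even `D` (certificate C83X). [folklore] -/
theorem checkDnRow0_5_weilCertDeflC83X : weilCertDeflC83XBase.checkDnRow weilCertDeflC83XDnE weilCertDeflC83XLsE 0 5 = true := by
  decide +kernel

set_option maxHeartbeats 0 in
/-- Row 6 of `DnE/LsE` is row 6 of the even `D` (certificate C83X). [folklore] -/
theorem checkDnRow0_6_weilCertDeflC83X : weilCertDeflC83XBase.checkDnRow weilCertDeflC83XDnE weilCertDeflC83XLsE 0 6 = true := by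
  decide +kernel

set_option maxHeartbeats 0 in
/-- Row 7 of `DnE/LsE` is row 7 of the even `D` (certificate C83X). [folklore] -/
theorem checkDnRow0_7_weilCertDeflC83X : weilCertDeflC83XBase.checkDnRow weilCertDeflC83XDnE weilCertDeflC83XLsE 0 7 = true := by
  decide +kernel


end Summit.RiemannHypothesis.RiemannHypothesis.Theorems.EvenWinsBeyondArch
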